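import Literature.Barriers.CriticalPhenomena.LaceExpansionLatticeFTHigherDeriv
import HarnessLib

/-!
# Hara 2008, Lemma 4.1: `|∂_j^m Ĝ(k)| ≤ c |k|^{-2-m}` for `Ĝ = ĝ/(1 - Ĵ)`, proved

Barrier catalogue `Literature/Barriers/CriticalPhenomena/` (D-0021), companion of
`LaceExpansionLatticeFTHigherDeriv.lean`, on the way to the analytic named fact `Hara2008_lemma17Pc`
(Hara 2008, Lemma 1.7) behind `Hara2008_xSpacePiBoundPc` (`LaceExpansionXSpaceNorms.lean`,
`LaceExpansionXSpaceBootstrap.lean`). Lemma 1.7 is proved in Hara's §4 from ONE `k`-space estimate,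
Lemma 4.1: if `Σ_x |x|^M |Π(x)| < ∞` then the lace-expansion representation
`Ĝ(k) = ĝ(k)/(1 - Ĵ(k))` of the two-point function satisfies `|∂_j^m Ĝ(k)| ≤ c|k|^{-2-m}` for
`1 ≤ m ≤ M` (the case `m = 0` being the infrared bound). This file PROVES it:

* `norm_iteratedDeriv_div_mul_pow_le` — the one-variable mechanism, by induction on `m` through the
  Leibniz rule for `Ĝ · (1 - Ĵ) = ĝ` (Mathlib's `iteratedDeriv_mul`): if at a point `t`,
  `‖v(t)‖ ≥ c₀ r²`, `‖v^{(ℓ)}(t)‖ r^ℓ ≤ B r²` (`1 ≤ ℓ ≤ M`) and `‖u^{(ℓ)}(t)‖ r^{a+ℓ} ≤ B` (`ℓ ≤ M`),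
  then `‖(u/v)^{(m)}(t)‖ r^{a+2+m} ≤ C_m` with `C_m` depending on `m, c₀, B` only (Hara's power
  counting (4.21)–(4.27), organised as: the term with `m` derivatives on `Ĝ` is isolated, every
  other term has either `≥ 2` derivatives on `Ĵ` (bounded) or exactly one (`≤ c|k|`, (4.22)));
* `kspaceTwoPoint J g = ĝ/(1 - Ĵ)`, `sliceDeriv F j m k = ∂_j^m F(k)` (the `m`-th derivative of
  `s ↦ F(k[j ↦ s])` at `s = k_j`);
* `norm_sliceDeriv_kspaceTwoPoint_le` — **Lemma 4.1** for a `ℤ^d`-symmetric kernel `J` and a source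
  `g` with `Σ_x (1+|x|)^M (|J| + |g|) < ∞`, `M ≥ 2`, and the `k`-space lower bound
  `c₀|k|² ≤ |1 - Ĵ(k)|` on `[-π,π]^d`: for every `m ≤ M` there is `C` with
  `‖∂_j^m Ĝ(k)‖ ≤ C/|k|^{2+m}` on `[-π,π]^d ∖ {0}`;
* `IsLaceCoefficientPc.exists_norm_sliceDeriv_le` — the same at `p = p_c` for a lace-expansion
  coefficient `Φ` of critical percolation (`J = 2dp_c D ⋆ (δ₀ + Π)`, `g = δ₀ + Π`) with
  `Σ_x (1+|x|)^M |Π(x)| < ∞`, `M ≥ 2` (moments of `g`, `J` from those of `Π`; the lower bound from the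
  infrared clause of `IsLaceCoefficientPc`).

Scope note. Hara states Lemma 4.1 for "a positive integer `M`" and `1 ≤ m ≤ M`; the parity step
(4.22) of his proof (`|∂Ĵ(k)| ≤ sup|∂²Ĵ| |k|`) uses two derivatives of `Ĵ`, available in his
setting from the standing bound `Σ_x |x|²|Π_p(x)| ≤ c/d` of Prop. 1.2; here this is the explicit
hypothesis `M ≥ 2` (all uses in §1.2.4 have `M = ⌊φ⌋ ≥ 2`).

## References

* T. Hara, Ann. Probab. 36 (2008) 530–593 (arXiv:math-ph/0504021): Lemma 4.1 ((4.6)–(4.7)) and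
  its proof, §4.2 ((4.20)–(4.27)); Prop. 1.2 ((1.17): `Σ_x |x|²|Π_p(x)| ≤ c/d`,
  `c₁|k|²/d ≤ Ĵ_p(0) - Ĵ_p(k)`).
-/

noncomputable section

namespace Literature.Barriers.CriticalPhenomena

open Filter Finset Literature.Probability.LatticeModels Literature.Probability.Percolation
open scoped Topology BigOperators

variable {d : ℕ}

/-! ### The one-variable mechanism: derivatives of a quotient `u/v` with `|v| ≳ r²` -/

/-- **Derivatives of a quotient by power counting.** Fix `M, a ∈ ℕ`, `c₀ > 0`, `B ≥ 0`. For every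
`m` there is `C ≥ 0` such that: whenever `u, v : ℝ → ℂ` are `C^M` at `t`, `0 < r`, `m ≤ M`,
`c₀ r² ≤ ‖v(t)‖`, `‖v^{(ℓ)}(t)‖ r^ℓ ≤ B r²` for `1 ≤ ℓ ≤ M` and `‖u^{(ℓ)}(t)‖ r^{a+ℓ} ≤ B` for
`ℓ ≤ M`, then `‖(u/v)^{(m)}(t)‖ r^{a+2+m} ≤ C`. Proof: Leibniz on `(u/v) · v = u` near `t`, isolate
the top term, induct (Hara's (4.21)–(4.27) with the bookkeeping "each term has `(m-i)` derivatives on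
`v`, costing `r^{2-(m-i)}`, and `i < m` on `u/v`, costing `r^{-a-2-i}`").
[cite: Hara2008, proof of Lemma 4.1 (§4.2, (4.21)–(4.27))] -/
theorem norm_iteratedDeriv_div_mul_pow_le (M a : ℕ) {c₀ B : ℝ} (hc₀ : 0 < c₀) (hB : 0 ≤ B) (m : ℕ) :
    ∃ C : ℝ, 0 ≤ C ∧ ∀ (u v : ℝ → ℂ) (t r : ℝ), 0 < r → m ≤ M →
      ContDiffAt ℝ M u t → ContDiffAt ℝ M v t →
      c₀ * r ^ 2 ≤ ‖v t‖ →
      (∀ ℓ : ℕ, 1 ≤ ℓ → ℓ ≤ M → ‖iteratedDeriv ℓ v t‖ * r ^ ℓ ≤ B * r ^ 2) →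
      (∀ ℓ : ℕ, ℓ ≤ M → ‖iteratedDeriv ℓ u t‖ * r ^ (a + ℓ) ≤ B) →
      ‖iteratedDeriv m (fun s => u s / v s) t‖ * r ^ (a + 2 + m) ≤ C := by
  induction m using Nat.strong_induction_on with
  | _ m ih =>
  choose! C hC using ih
  have hC0 : ∀ i ∈ Finset.range m, 0 ≤ C i := fun i hi => (hC i (Finset.mem_range.1 hi)).1
  refine ⟨(B + ∑ i ∈ Finset.range m, (m.choose i : ℝ) * C i * B) / c₀, ?_, ?_⟩
  · refine div_nonneg (add_nonneg hB (Finset.sum_nonneg fun i hi => ?_)) hc₀.le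
    exact mul_nonneg (mul_nonneg (Nat.cast_nonneg _) (hC0 i hi)) hB
  intro u v t r hr hmM hu hv hv0 hvl hul
  have hr2 : 0 < r ^ 2 := pow_pos hr 2
  have hvt : v t ≠ 0 := by
    intro h0
    rw [h0, norm_zero] at hv0
    nlinarith [mul_pos hc₀ hr2]
  -- the quotient and its regularity
  set w : ℝ → ℂ := fun s => u s / v s with hw_def
  have hw : ContDiffAt ℝ M w t := by
    have h1 : ContDiffAt ℝ M (fun s => u s * (v s)⁻¹) t := hu.mul (hv.inv hvt)
    have h2 : w = fun s => u s * (v s)⁻¹ := funext fun s => div_eq_mul_inv _ _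
    rw [h2]
    exact h1
  have hmM' : (m : WithTop ℕ∞) ≤ (M : WithTop ℕ∞) := by exact_mod_cast hmM
  -- Leibniz for `w · v = u` near `t`
  have hL := iteratedDeriv_fun_mul (hw.of_le hmM') (hv.of_le hmM')
  have hev : (fun s => w s * v s) =ᶠ[𝓝 t] u := by
    filter_upwards [hv.continuousAt.eventually_ne hvt] with s hs
    simp only [hw_def]
    exact div_mul_cancel₀ (u s) hs
  rw [hev.iteratedDeriv_eq m, Finset.sum_range_succ, Nat.choose_self, Nat.sub_self, iteratedDeriv_zero,
    Nat.cast_one, one_mul] at hL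
  -- `w^{(m)}(t) v(t) = u^{(m)}(t) - Σ_{i<m} (m choose i) w^{(i)}(t) v^{(m-i)}(t)`
  set D : ℂ := iteratedDeriv m w t with hD_def
  set S : ℝ := ∑ i ∈ Finset.range m,
    (m.choose i : ℝ) * ‖iteratedDeriv i w t‖ * ‖iteratedDeriv (m - i) v t‖ with hS_def
  have hD : D * v t = iteratedDeriv m u t -
      ∑ i ∈ Finset.range m, (m.choose i : ℂ) * iteratedDeriv i w t * iteratedDeriv (m - i) v t := by
    rw [hL]
    ring
  have hnorm : ‖D‖ * ‖v t‖ ≤ ‖iteratedDeriv m u t‖ + S := by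
    rw [← norm_mul, hD]
    refine (norm_sub_le _ _).trans (add_le_add le_rfl ?_)
    refine (norm_sum_le _ _).trans (le_of_eq (Finset.sum_congr rfl fun i _ => ?_))
    rw [norm_mul, norm_mul, Complex.norm_natCast]
  -- power counting
  have hmain : ‖D‖ * r ^ (a + 2 + m) * c₀ * r ^ 2 ≤
      (B + ∑ i ∈ Finset.range m, (m.choose i : ℝ) * C i * B) * r ^ 2 := by
    have hsum : S * r ^ (a + 2 + m) ≤ (∑ i ∈ Finset.range m, (m.choose i : ℝ) * C i * B) * r ^ 2 := by
      rw [hS_def, Finset.sum_mul, Finset.sum_mul]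
      refine Finset.sum_le_sum fun i hi => ?_
      have him : i < m := Finset.mem_range.1 hi
      have hexp : a + 2 + m = (a + 2 + i) + (m - i) := by omega
      have hwi : ‖iteratedDeriv i w t‖ * r ^ (a + 2 + i) ≤ C i :=
        (hC i him).2 u v t r hr (le_trans him.le hmM) hu hv hv0 hvl hul
      have hvi : ‖iteratedDeriv (m - i) v t‖ * r ^ (m - i) ≤ B * r ^ 2 :=
        hvl (m - i) (by omega) (le_trans (Nat.sub_le m i) hmM)
      have hPnn : 0 ≤ ‖iteratedDeriv (m - i) v t‖ * r ^ (m - i) := by positivity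
      calc (m.choose i : ℝ) * ‖iteratedDeriv i w t‖ * ‖iteratedDeriv (m - i) v t‖ * r ^ (a + 2 + m)
          = (m.choose i : ℝ) * ((‖iteratedDeriv i w t‖ * r ^ (a + 2 + i)) *
              (‖iteratedDeriv (m - i) v t‖ * r ^ (m - i))) := by
            rw [hexp, pow_add]
            ring
        _ ≤ (m.choose i : ℝ) * (C i * (B * r ^ 2)) := by
            refine mul_le_mul_of_nonneg_left ?_ (Nat.cast_nonneg _)
            exact mul_le_mul hwi hvi hPnn (hC0 i hi)
        _ = (m.choose i : ℝ) * C i * B * r ^ 2 := by ring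
    have hu' : ‖iteratedDeriv m u t‖ * r ^ (a + 2 + m) ≤ B * r ^ 2 := by
      have h := hul m hmM
      calc ‖iteratedDeriv m u t‖ * r ^ (a + 2 + m) = ‖iteratedDeriv m u t‖ * r ^ (a + m) * r ^ 2 := by
            ring
        _ ≤ B * r ^ 2 := mul_le_mul_of_nonneg_right h hr2.le
    calc ‖D‖ * r ^ (a + 2 + m) * c₀ * r ^ 2 = ‖D‖ * (c₀ * r ^ 2) * r ^ (a + 2 + m) := by ring
      _ ≤ ‖D‖ * ‖v t‖ * r ^ (a + 2 + m) := by gcongr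
      _ ≤ (‖iteratedDeriv m u t‖ + S) * r ^ (a + 2 + m) := by gcongr
      _ = ‖iteratedDeriv m u t‖ * r ^ (a + 2 + m) + S * r ^ (a + 2 + m) := by ring
      _ ≤ B * r ^ 2 + (∑ i ∈ Finset.range m, (m.choose i : ℝ) * C i * B) * r ^ 2 :=
          add_le_add hu' hsum
      _ = (B + ∑ i ∈ Finset.range m, (m.choose i : ℝ) * C i * B) * r ^ 2 := by ring
  have h2 : ‖D‖ * r ^ (a + 2 + m) * c₀ ≤ B + ∑ i ∈ Finset.range m, (m.choose i : ℝ) * C i * B :=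
    le_of_mul_le_mul_right hmain hr2
  rw [le_div_iff₀ hc₀]
  exact h2

/-! ### `Ĝ = ĝ/(1 - Ĵ)` and coordinate derivatives of functions on `k`-space -/

/-- The `k`-space two-point function of the lace expansion, `Ĝ(k) := ĝ(k)/(1 - Ĵ(k))` (the
integrand of the representation `G(x) = ∫ e^{ikx} ĝ(k)/(1 - Ĵ(k)) d^dk/(2π)^d`; at `p = p_c` this is
how `Ĝ_{p_c}` is DEFINED, Appendix A item 4). [cite: Hara2008, Prop. 1.2 ((1.11)) and Appendix A (item 4)] -/
def kspaceTwoPoint (J g : Site d → ℝ) (k : Fin d → ℝ) : ℂ := latticeFT g k / (1 - latticeFT J k)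

/-- `∂_j^m F(k)`: the `m`-th derivative of the slice `s ↦ F(k[j ↦ s])` at `s = k_j` (Hara's
`∂^m = ∂^m/∂k_j^m`). [cite: Hara2008, §4.2 ("we abbreviate ∂^m for ∂^m/∂k₁^m")] -/
def sliceDeriv (F : (Fin d → ℝ) → ℂ) (j : Fin d) (m : ℕ) (k : Fin d → ℝ) : ℂ :=
  iteratedDeriv m (fun s : ℝ => F (Function.update k j s)) (k j)

/-- `∂_j^0 F = F`. [folklore] -/
@[simp] theorem sliceDeriv_zero (F : (Fin d → ℝ) → ℂ) (j : Fin d) (k : Fin d → ℝ) :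
    sliceDeriv F j 0 k = F k := by
  simp [sliceDeriv]

/-- For `f̂` itself, `∂_j^m f̂ = latticeFTDn f j m` (`m ≤ M`). [folklore] -/
theorem sliceDeriv_latticeFT {f : Site d → ℝ} {M : ℕ}
    (hM : Summable fun x => (1 + euclidNorm x) ^ M * |f x|) (j : Fin d) {m : ℕ} (hm : m ≤ M)
    (k : Fin d → ℝ) : sliceDeriv (latticeFT f) j m k = latticeFTDn f j m k :=
  iteratedDeriv_latticeFT_update_apply hM k j hm

/-- The derivatives of the slice of `1 - Ĵ`: `(1 - Ĵ)^{(ℓ)} = -∂_j^ℓ Ĵ` for `1 ≤ ℓ ≤ M`. [folklore] -/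
theorem iteratedDeriv_one_sub_latticeFT_update {J : Site d → ℝ} {M : ℕ}
    (hM : Summable fun x => (1 + euclidNorm x) ^ M * |J x|) (k : Fin d → ℝ) (j : Fin d) {ℓ : ℕ}
    (hℓ1 : 1 ≤ ℓ) (hℓ : ℓ ≤ M) :
    iteratedDeriv ℓ (fun s : ℝ => 1 - latticeFT J (Function.update k j s)) (k j) =
      -latticeFTDn J j ℓ k := by
  rw [iteratedDeriv_const_sub (by omega) (1 : ℂ), iteratedDeriv_neg,
    iteratedDeriv_latticeFT_update_apply hM k j hℓ]

/-! ### Geometry of the cube: `|k|` on `[-π,π]^d` -/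

/-- `k ≠ 0 ⇒ |k| > 0`. [folklore] -/
theorem knorm_pos_of_ne_zero {k : Fin d → ℝ} (hk : k ≠ 0) : 0 < knorm k := by
  obtain ⟨j, hj⟩ : ∃ j, k j ≠ 0 := by
    by_contra h
    push Not at h
    exact hk (funext h)
  have h1 : 0 < |k j| := abs_pos.2 hj
  exact lt_of_lt_of_le h1 (abs_apply_le_knorm k j)

/-- On the cube, `|k| ≤ π √d`. [folklore] -/
theorem knorm_le_of_mem_cube {k : Fin d → ℝ} (hk : k ∈ cube d) : knorm k ≤ Real.pi * Real.sqrt d := by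
  have hki : ∀ i, k i ^ 2 ≤ Real.pi ^ 2 := by
    intro i
    have h := hk i (Set.mem_univ i)
    rw [Set.mem_Icc] at h
    exact (sq_le_sq' h.1 h.2)
  have hsum : ∑ i, k i ^ 2 ≤ d * Real.pi ^ 2 := by
    calc ∑ i, k i ^ 2 ≤ ∑ _i : Fin d, Real.pi ^ 2 := Finset.sum_le_sum fun i _ => hki i
      _ = d * Real.pi ^ 2 := by simp
  rw [knorm]
  calc Real.sqrt (∑ i, k i ^ 2) ≤ Real.sqrt (d * Real.pi ^ 2) := Real.sqrt_le_sqrt hsum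
    _ = Real.pi * Real.sqrt d := by
        rw [Real.sqrt_mul (Nat.cast_nonneg d), Real.sqrt_sq Real.pi_pos.le, mul_comm]

/-! ### Lemma 4.1 -/

/-- **Hara 2008, Lemma 4.1** (kernel/source form). Let `J, g : ℤ^d → ℝ` with
`Σ_x (1 + |x|)^M |J(x)|, Σ_x (1 + |x|)^M |g(x)| < ∞` for some `M ≥ 2`, `J` `ℤ^d`-symmetric, and
suppose the `k`-space lower bound `c₀ |k|² ≤ |1 - Ĵ(k)|` on `[-π,π]^d` (`c₀ > 0`). Then for every
coordinate `j` and every `m ≤ M` there is `C` such that `Ĝ = ĝ/(1 - Ĵ)` satisfies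
`‖∂_j^m Ĝ(k)‖ ≤ C / |k|^{2+m}` for all `k ∈ [-π,π]^d ∖ {0}` ("`|∂^m Ĝ(k)| ≤ c/|k|^{2+m}` with a
possibly `m`-dependent constant `c`"; `m = 0` is the infrared bound `|Ĝ(k)| ≤ c/|k|²`).
[cite: Hara2008, Lemma 4.1 ((4.6)–(4.7)) and its proof (§4.2)] -/
theorem norm_sliceDeriv_kspaceTwoPoint_le {J g : Site d → ℝ} {M : ℕ} (hM2 : 2 ≤ M)
    (hJ : Summable fun x => (1 + euclidNorm x) ^ M * |J x|)
    (hg : Summable fun x => (1 + euclidNorm x) ^ M * |g x|) (hJs : IsZdSymmetric J)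
    {c₀ : ℝ} (hc₀ : 0 < c₀) (hlow : ∀ k ∈ cube d, c₀ * knorm k ^ 2 ≤ ‖1 - latticeFT J k‖)
    (j : Fin d) {m : ℕ} (hm : m ≤ M) :
    ∃ C : ℝ, ∀ k ∈ cube d, k ≠ 0 →
      ‖sliceDeriv (kspaceTwoPoint J g) j m k‖ ≤ C / knorm k ^ (2 + m) := by
  -- the constants
  set R : ℝ := max 1 (Real.pi * Real.sqrt d) with hR_def
  have hR1 : 1 ≤ R := le_max_left _ _
  have hR0 : 0 ≤ R := zero_le_one.trans hR1
  set KJ : ℝ := ∑' x, (1 + euclidNorm x) ^ M * |J x| with hKJ_def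
  set Kg : ℝ := ∑' x, (1 + euclidNorm x) ^ M * |g x| with hKg_def
  set K₂ : ℝ := ∑' x, euclidNorm x ^ 2 * |J x| with hK₂_def
  have hKJ0 : 0 ≤ KJ := tsum_nonneg fun x => moment_term_nonneg M J x
  have hKg0 : 0 ≤ Kg := tsum_nonneg fun x => moment_term_nonneg M g x
  have hK₂0 : 0 ≤ K₂ := tsum_nonneg fun x => mul_nonneg (sq_nonneg _) (abs_nonneg _)
  set B : ℝ := (K₂ + KJ + Kg) * R ^ M with hB_def
  have hRM : 1 ≤ R ^ M := one_le_pow₀ hR1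
  have hB0 : 0 ≤ B := mul_nonneg (by linarith) (zero_le_one.trans hRM)
  have hJ0 : Summable fun x => |J x| := summable_abs_of_moment hJ
  have hJ2 : Summable fun x => euclidNorm x ^ 2 * |J x| := summable_sq_mul_abs_of_moment hJ hM2
  obtain ⟨C, -, hC⟩ := norm_iteratedDeriv_div_mul_pow_le M 0 hc₀ hB0 m
  refine ⟨C, fun k hk hk0 => ?_⟩
  have hr : 0 < knorm k := knorm_pos_of_ne_zero hk0
  have hrR : knorm k ≤ R := (knorm_le_of_mem_cube hk).trans (le_max_right _ _)
  have hpowR : ∀ n : ℕ, n ≤ M → knorm k ^ n ≤ R ^ M := fun n hn =>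
    (pow_le_pow_left₀ hr.le hrR n).trans (pow_le_pow_right₀ hR1 hn)
  -- the two slices
  set u : ℝ → ℂ := fun s => latticeFT g (Function.update k j s) with hu_def
  set v : ℝ → ℂ := fun s => 1 - latticeFT J (Function.update k j s) with hv_def
  have hu : ContDiffAt ℝ M u (k j) := contDiffAt_latticeFT_update hg k j (k j)
  have hv : ContDiffAt ℝ M v (k j) :=
    (contDiff_const.sub (contDiff_latticeFT_update hJ k j)).contDiffAt
  have hv0 : c₀ * knorm k ^ 2 ≤ ‖v (k j)‖ := by
    simp only [hv_def, Function.update_eq_self]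
    exact hlow k hk
  have hvl : ∀ ℓ : ℕ, 1 ≤ ℓ → ℓ ≤ M → ‖iteratedDeriv ℓ v (k j)‖ * knorm k ^ ℓ ≤ B * knorm k ^ 2 := by
    intro ℓ hℓ1 hℓM
    rw [hv_def, iteratedDeriv_one_sub_latticeFT_update hJ k j hℓ1 hℓM, norm_neg]
    rcases Nat.lt_or_ge ℓ 2 with hlt | hge
    · -- `ℓ = 1`: the derivative vanishes linearly on `k_j = 0`
      obtain rfl : ℓ = 1 := by omega
      have h1 := norm_latticeFTDn_one_le hJs hJ0 hJ2 j k
      calc ‖latticeFTDn J j 1 k‖ * knorm k ^ 1 ≤ K₂ * knorm k * knorm k ^ 1 :=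
            mul_le_mul_of_nonneg_right h1 (pow_nonneg hr.le 1)
        _ = K₂ * 1 * knorm k ^ 2 := by ring
        _ ≤ (K₂ + KJ + Kg) * R ^ M * knorm k ^ 2 := by
            gcongr
            · linarith
    · -- `ℓ ≥ 2`: bounded derivative, `|k|^ℓ = |k|^{ℓ-2} |k|² ≤ R^M |k|²`
      have h1 := norm_latticeFTDn_le hJ j hℓM k
      obtain ⟨n, rfl⟩ : ∃ n, ℓ = n + 2 := ⟨ℓ - 2, by omega⟩
      calc ‖latticeFTDn J j (n + 2) k‖ * knorm k ^ (n + 2)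
          = ‖latticeFTDn J j (n + 2) k‖ * knorm k ^ n * knorm k ^ 2 := by ring
        _ ≤ KJ * R ^ M * knorm k ^ 2 :=
            mul_le_mul_of_nonneg_right (mul_le_mul h1 (hpowR n (by omega)) (pow_nonneg hr.le n) hKJ0)
              (pow_nonneg hr.le 2)
        _ ≤ (K₂ + KJ + Kg) * R ^ M * knorm k ^ 2 := by
            gcongr
            linarith
  have hul : ∀ ℓ : ℕ, ℓ ≤ M → ‖iteratedDeriv ℓ u (k j)‖ * knorm k ^ (0 + ℓ) ≤ B := by
    intro ℓ hℓM
    rw [zero_add, hu_def, iteratedDeriv_latticeFT_update_apply hg k j hℓM]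
    calc ‖latticeFTDn g j ℓ k‖ * knorm k ^ ℓ ≤ Kg * R ^ M :=
          mul_le_mul (norm_latticeFTDn_le hg j hℓM k) (hpowR ℓ hℓM) (pow_nonneg hr.le ℓ) hKg0
      _ ≤ (K₂ + KJ + Kg) * R ^ M := by
          gcongr
          linarith
  have h := hC u v (k j) (knorm k) hr hm hu hv hv0 hvl hul
  simp only [zero_add] at h
  have hD : sliceDeriv (kspaceTwoPoint J g) j m k = iteratedDeriv m (fun s => u s / v s) (k j) := rfl
  rw [hD, le_div_iff₀ (pow_pos hr _)]
  exact h

/-! ### Lemma 4.1 at `p = p_c` for a lace-expansion coefficient -/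

/-- `|y| ≤ |y + eᵢ·s| + 1` for `s = ±1`. [folklore] -/
theorem euclidNorm_le_euclidNorm_add_single_add_one (y : Site d) (i : Fin d) {s : ℤ}
    (hs : s = 1 ∨ s = -1) : euclidNorm y ≤ euclidNorm (y + Pi.single i s) + 1 := by
  have h := euclidNorm_add_le (y + Pi.single i s) (-(Pi.single i s))
  rw [add_neg_cancel_right, euclidNorm_neg, euclidNorm_single] at h
  rcases hs with rfl | rfl <;> simpa using h

/-- Moments survive a unit shift: `Σ_y (1+|y|)^M |f(y + s eᵢ)| ≤ 2^M Σ_y (1+|y|)^M |f(y)|`, in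
summability form. [folklore] -/
theorem summable_moment_comp_add_single {f : Site d → ℝ} {M : ℕ}
    (hM : Summable fun x => (1 + euclidNorm x) ^ M * |f x|) (i : Fin d) {s : ℤ} (hs : s = 1 ∨ s = -1) :
    Summable fun y : Site d => (1 + euclidNorm y) ^ M * |f (y + Pi.single i s)| := by
  have hshift : Summable fun y : Site d =>
      (1 + euclidNorm (y + Pi.single i s)) ^ M * |f (y + Pi.single i s)| :=
    summable_comp_add_right (f := fun x => (1 + euclidNorm x) ^ M * |f x|) hM (Pi.single i s)
  refine Summable.of_nonneg_of_le (fun y => moment_term_nonneg M (fun y => f (y + Pi.single i s)) y)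
    (fun y => ?_) (hshift.mul_left ((2 : ℝ) ^ M))
  have h1 : 1 + euclidNorm y ≤ 2 * (1 + euclidNorm (y + Pi.single i s)) := by
    linarith [euclidNorm_le_euclidNorm_add_single_add_one y i hs, euclidNorm_nonneg (y + Pi.single i s)]
  calc (1 + euclidNorm y) ^ M * |f (y + Pi.single i s)|
      ≤ (2 * (1 + euclidNorm (y + Pi.single i s))) ^ M * |f (y + Pi.single i s)| := by
        gcongr
        · linarith [euclidNorm_nonneg y]
    _ = 2 ^ M * ((1 + euclidNorm (y + Pi.single i s)) ^ M * |f (y + Pi.single i s)|) := by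
        rw [mul_pow]
        ring

/-- Moments of the source `g = δ₀ + Π` from those of `Π`. [folklore] -/
theorem summable_moment_laceSource {Φ : Site d → ℝ} {M : ℕ}
    (hM : Summable fun x => (1 + euclidNorm x) ^ M * |Φ x|) :
    Summable fun x => (1 + euclidNorm x) ^ M * |laceSource Φ x| := by
  have hδ : Summable fun x : Site d => (1 + euclidNorm x) ^ M * |(if x = 0 then (1 : ℝ) else 0)| :=
    summable_of_ne_finset_zero (s := {0}) fun x hx => by
      rw [Finset.mem_singleton] at hx
      rw [if_neg hx, abs_zero, mul_zero]
  refine Summable.of_nonneg_of_le (fun x => moment_term_nonneg M _ x) (fun x => ?_) (hδ.add hM)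
  rw [laceSource, ← mul_add]
  exact mul_le_mul_of_nonneg_left (abs_add_le _ _) (pow_nonneg (by linarith [euclidNorm_nonneg x]) M)

/-- Moments of the kernel `J = 2dp D ⋆ g` from those of `Π` (`D` has range one).
[cite: Hara2008, Prop. 1.2 (Ĵ_p = 2dp D̂ ĝ_p) and Lemma 4.1 ((4.20))] -/
theorem summable_moment_laceKernel {Φ : Site d → ℝ} {M : ℕ}
    (hM : Summable fun x => (1 + euclidNorm x) ^ M * |Φ x|) (p : ℝ) :
    Summable fun y => (1 + euclidNorm y) ^ M * |laceKernel p Φ y| := by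
  have hg := summable_moment_laceSource hM
  have hsub : ∀ (i : Fin d) (y : Site d),
      y - (Pi.single i (1 : ℤ) : Site d) = y + (Pi.single i (-1 : ℤ) : Site d) := fun i y => by
    rw [sub_eq_add_neg, ← Pi.single_neg]
  have hterm : ∀ i : Fin d, Summable fun y : Site d => (1 + euclidNorm y) ^ M *
      (|laceSource Φ (y + Pi.single i 1)| + |laceSource Φ (y - Pi.single i 1)|) := by
    intro i
    simp_rw [hsub i, mul_add]
    exact (summable_moment_comp_add_single hg i (Or.inl rfl)).add
      (summable_moment_comp_add_single hg i (Or.inr rfl))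
  have hsum := (summable_sum fun i (_ : i ∈ Finset.univ) => hterm i).mul_left |p|
  refine Summable.of_nonneg_of_le (fun y => moment_term_nonneg M _ y) (fun y => ?_) hsum
  rw [laceKernel, abs_mul]
  calc (1 + euclidNorm y) ^ M * (|p| * |∑ i, (laceSource Φ (y + Pi.single i 1) + laceSource Φ (y - Pi.single i 1))|)
      = |p| * ((1 + euclidNorm y) ^ M *
          |∑ i, (laceSource Φ (y + Pi.single i 1) + laceSource Φ (y - Pi.single i 1))|) := by ring
    _ ≤ |p| * ∑ i, (1 + euclidNorm y) ^ M *
          (|laceSource Φ (y + Pi.single i 1)| + |laceSource Φ (y - Pi.single i 1)|) := by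
        refine mul_le_mul_of_nonneg_left ?_ (abs_nonneg p)
        rw [← Finset.mul_sum]
        refine mul_le_mul_of_nonneg_left ?_ (pow_nonneg (by linarith [euclidNorm_nonneg y]) M)
        refine (Finset.abs_sum_le_sum_abs _ _).trans (Finset.sum_le_sum fun i _ => abs_add_le _ _)

/-- The infrared clause of `IsLaceCoefficientPc` as a lower bound on `|1 - Ĵ(k)|`:
`(c₁/d) |k|² ≤ ‖1 - Ĵ(k)‖` on the cube. [cite: Hara2008, Prop. 1.2 ((1.17): c₁|k|²/d ≤ Ĵ_p(0) - Ĵ_p(k))] -/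
theorem IsLaceCoefficientPc.exists_knorm_sq_le_norm {Φ : Site d → ℝ} (h : IsLaceCoefficientPc d Φ) :
    ∃ c₀ : ℝ, 0 < c₀ ∧ ∀ k ∈ cube d,
      c₀ * knorm k ^ 2 ≤ ‖(1 : ℂ) - latticeFT (laceKernel (criticalProbI d) Φ) k‖ := by
  obtain ⟨c₁, hc₁, hlow⟩ := h.lower
  rcases Nat.eq_zero_or_pos d with hd | hd
  · -- `d = 0`: `knorm k = 0`
    refine ⟨1, one_pos, fun k _ => ?_⟩
    subst hd
    have : knorm k = 0 := by simp [knorm]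
    rw [this]
    simp
  have hd' : (0 : ℝ) < d := by exact_mod_cast hd
  refine ⟨c₁ / d, div_pos hc₁ hd', fun k hk => ?_⟩
  have h1 := hlow k hk
  rw [knorm_sq]
  calc c₁ / d * ∑ i, k i ^ 2 = c₁ * (∑ i, k i ^ 2) / d := by ring
    _ ≤ 1 - (latticeFT (laceKernel (criticalProbI d) Φ) k).re := h1
    _ = ((1 : ℂ) - latticeFT (laceKernel (criticalProbI d) Φ) k).re := by simp
    _ ≤ _ := Complex.re_le_norm _

/-- **Hara 2008, Lemma 4.1 at `p = p_c`, percolation.** For a lace-expansion coefficient `Φ = Π_{p_c}`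
of critical bond percolation on `ℤ^d` (`IsLaceCoefficientPc d Φ`) with `Σ_x (1+|x|)^M |Π(x)| < ∞`
for some `M ≥ 2`, the `k`-space two-point function `Ĝ = ĝ/(1 - Ĵ)` (`g = δ₀ + Π`,
`J = 2dp_c D ⋆ g`) satisfies, for every coordinate `j` and every `m ≤ M`,
`‖∂_j^m Ĝ(k)‖ ≤ C/|k|^{2+m}` on `[-π,π]^d ∖ {0}`.
[cite: Hara2008, Lemma 4.1 ((4.6)–(4.7))] -/
theorem IsLaceCoefficientPc.exists_norm_sliceDeriv_le {Φ : Site d → ℝ} (h : IsLaceCoefficientPc d Φ)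
    {M : ℕ} (hM2 : 2 ≤ M) (hmom : Summable fun x => (1 + euclidNorm x) ^ M * |Φ x|) (j : Fin d)
    {m : ℕ} (hm : m ≤ M) :
    ∃ C : ℝ, ∀ k ∈ cube d, k ≠ 0 →
      ‖sliceDeriv (kspaceTwoPoint (laceKernel (criticalProbI d) Φ) (laceSource Φ)) j m k‖ ≤
        C / knorm k ^ (2 + m) := by
  obtain ⟨c₀, hc₀, hlow⟩ := h.exists_knorm_sq_le_norm
  exact norm_sliceDeriv_kspaceTwoPoint_le hM2 (summable_moment_laceKernel hmom _)
    (summable_moment_laceSource hmom) (isZdSymmetric_laceKernel h.symm _) hc₀ hlow j hm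

/-- The same from the hypotheses as they appear in Lemma 1.7 / the recursion of §1.2.4: a real
moment `Σ_x |x|^φ |Π(x)| < ∞` with `φ ≥ 2` gives Lemma 4.1 for all `m ≤ ⌊φ⌋`.
[cite: Hara2008, Lemma 1.7 and Lemma 4.1] -/
theorem IsLaceCoefficientPc.exists_norm_sliceDeriv_le_of_rpow {Φ : Site d → ℝ}
    (h : IsLaceCoefficientPc d Φ) {φ : ℝ} (hφ2 : 2 ≤ φ)
    (hmom : Summable fun x => euclidNorm x ^ φ * |Φ x|) (j : Fin d) {m : ℕ} (hm : m ≤ ⌊φ⌋₊) :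
    ∃ C : ℝ, ∀ k ∈ cube d, k ≠ 0 →
      ‖sliceDeriv (kspaceTwoPoint (laceKernel (criticalProbI d) Φ) (laceSource Φ)) j m k‖ ≤
        C / knorm k ^ (2 + m) := by
  have hM : Summable fun x => (1 + euclidNorm x) ^ ⌊φ⌋₊ * |Φ x| :=
    summable_one_add_pow_mul_abs_of_rpow (Nat.floor_le (by linarith)) h.summable_abs hmom
  have h2 : 2 ≤ ⌊φ⌋₊ := Nat.le_floor (by exact_mod_cast hφ2)
  exact h.exists_norm_sliceDeriv_le h2 hM j hm

end Literature.Barriers.CriticalPhenomena
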